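import Literature.NumberTheory.Transcendental.BallRivoalBricks
import HarnessLib

/-!
# Ball–Rivoal series, II: Rivoal's rational function as a product of bricks

Topic `Literature/NumberTheory/Transcendental`. Continuation of `BallRivoalBricks.lean`, toward
the discharge of **periods.S19** (`Literature.NumberTheory.Transcendental.ball_rivoal`,
`PeriodsWave0.lean`). Rivoal's rational function [Rivoal2000, §1]

`R_n(t) = n!^{a-2r} (t - rn + 1)_{rn} (t + n + 2)_{rn} / (t+1)_{n+1}^a`    (`R a r n t`)

(`(α)_k` the Pochhammer symbol, `1 ≤ r`, `2r < a`) is written as the product of the `a` bricks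
of [Rivoal2000, proof of Lemme 5]:
`F_l(t) = (t - nl + 1)_n/(t+1)_{n+1}`, `G_l(t) = (t + nl + 2)_n/(t+1)_{n+1}` (`1 ≤ l ≤ r`) and
`H(t) = n!/(t+1)_{n+1}` (`a - 2r` times) — `R_eq_prod_brickEval` — each of which is a brick
`∑_m A_m/(t+m+1)` with the explicit integer residues (Lagrange interpolation at `-1, …, -n-1`,
`lagrange_div`)

* `H`:   `A_m = (-1)^m C(n,m)`                    (`resH`,  `H_eq_brickEval`),
* `F_l`: `A_m = (-1)^{n+m} C(n,m) C(m+nl, n)`     (`resF`,  `F_eq_brickEval`),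
* `G_l`: `A_m = (-1)^m C(n,m) C(n(l+1)-m, n)`     (`resG`,  `G_eq_brickEval`),

with `∑_m |A_m| ≤ 2^n C(n(l+1), n)` (`sum_abs_res*_le`). Feeding this to
`BallRivoal.exists_pf_prod` gives the partial fraction expansion of `R_n` with
`d_n^{a-1-o} c_{o,p} ∈ ℤ` and `∑|c_{o,p}| ≤ a! 2^{an} ∏_{l ≤ r} C((l+1)n,n)^2`
(`exists_pf_R`). Everything is PROVED; no named facts.

## References

* [Rivoal2000] T. Rivoal, C. R. Acad. Sci. Paris Sér. I 331 (2000) 267–270, arXiv:math/0008051,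
  §1 (definition of `R_n`), §2 Lemme 5 (the bricks `F_l, G_l, H`).
-/

noncomputable section

open Finset Polynomial

namespace Literature.NumberTheory.Transcendental

namespace BallRivoal

/-! ### Pochhammer products over `ℚ` -/

/-- The Pochhammer symbol `(t)_k = t (t+1) ⋯ (t+k-1)` as a rational number. [folklore] -/
def poch (t : ℚ) (k : ℕ) : ℚ := ∏ s ∈ range k, (t + s)

/-- `(t)_{k n} = ∏_{L<k} (t + L n)_n`. [folklore] -/
theorem poch_mul (t : ℚ) (k n : ℕ) :
    poch t (k * n) = ∏ L ∈ range k, poch (t + L * n) n := by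
  induction k with
  | zero => simp [poch]
  | succ k ih =>
    rw [prod_range_succ, ← ih, Nat.succ_mul, poch, poch, prod_range_add]
    congr 1
    refine prod_congr rfl fun s _ => ?_
    push_cast
    ring

/-- `(N+1)_n = n! C(N+n, n)` for a natural number `N`. [folklore] -/
theorem poch_natCast_succ (N n : ℕ) :
    poch ((N : ℚ) + 1) n = (n.factorial : ℚ) * ((N + n).choose n : ℚ) := by
  have h : (N + 1).ascFactorial n = n.factorial * (N + n).choose n :=
    Nat.ascFactorial_eq_factorial_mul_choose N n
  have h' : (((N + 1).ascFactorial n : ℕ) : ℚ) = poch ((N : ℚ) + 1) n := by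
    rw [Nat.ascFactorial_eq_prod_range, Nat.cast_prod, poch]
    refine prod_congr rfl fun s _ => ?_
    push_cast
    ring
  rw [← h', h]
  push_cast
  ring

/-- `(-N)_n = (-1)^n n! C(N, n)` for a natural number `N`. [folklore] -/
theorem poch_neg_natCast (N n : ℕ) :
    poch (-(N : ℚ)) n = (-1) ^ n * (n.factorial : ℚ) * (N.choose n : ℚ) := by
  by_cases h : n ≤ N
  · have h1 : ((N.descFactorial n : ℕ) : ℚ) = ∏ s ∈ range n, ((N : ℚ) - s) := by
      rw [Nat.descFactorial_eq_prod_range, Nat.cast_prod]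
      refine prod_congr rfl fun s hs => ?_
      rw [Nat.cast_sub ((mem_range.1 hs).le.trans h)]
    have h2 : poch (-(N : ℚ)) n = (-1) ^ n * ∏ s ∈ range n, ((N : ℚ) - s) := by
      rw [poch, show ((-1 : ℚ)) ^ n = ∏ _s ∈ range n, (-1 : ℚ) by rw [prod_const, card_range],
        ← prod_mul_distrib]
      exact prod_congr rfl fun s _ => by ring
    rw [h2, ← h1, Nat.descFactorial_eq_factorial_mul_choose]
    push_cast
    ring
  · push Not at h
    rw [Nat.choose_eq_zero_of_lt h, poch]
    simp only [Nat.cast_zero, mul_zero]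
    exact prod_eq_zero (mem_range.2 h) (by ring)

/-! ### Lagrange interpolation at `-1, …, -(n+1)` divided by `(t+1)_{n+1}` -/

/-- `∏_{j ≤ n, j ≠ i} (j - i) = (-1)^i i! (n-i)!`. [folklore] -/
theorem prod_erase_sub (n i : ℕ) (hi : i ≤ n) :
    ∏ j ∈ (range (n + 1)).erase i, ((j : ℚ) - i) =
      (-1) ^ i * (i.factorial : ℚ) * ((n - i).factorial : ℚ) := by
  have hsplit : (range (n + 1)).erase i = range i ∪ Ico (i + 1) (n + 1) := by
    ext j
    simp only [mem_erase, mem_range, mem_union, mem_Ico]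
    omega
  have hdisj : Disjoint (range i) (Ico (i + 1) (n + 1)) := by
    rw [disjoint_left]
    intro j hj hj'
    simp only [mem_range] at hj
    simp only [mem_Ico] at hj'
    omega
  rw [hsplit, prod_union hdisj]
  have h1 : ∏ j ∈ range i, ((j : ℚ) - i) = (-1) ^ i * (i.factorial : ℚ) := by
    have e1 : ∏ j ∈ range i, ((j : ℚ) - i) = (-1) ^ i * ∏ j ∈ range i, ((i : ℚ) - j) := by
      rw [show ((-1 : ℚ)) ^ i = ∏ _s ∈ range i, (-1 : ℚ) by rw [prod_const, card_range],
        ← prod_mul_distrib]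
      exact prod_congr rfl fun s _ => by ring
    have e2 : ∏ j ∈ range i, ((i : ℚ) - j) = (i.factorial : ℚ) := by
      rw [← Nat.descFactorial_self, Nat.descFactorial_eq_prod_range, Nat.cast_prod]
      exact prod_congr rfl fun j hj => by rw [Nat.cast_sub (mem_range.1 hj).le]
    rw [e1, e2]
  have h2 : ∏ j ∈ Ico (i + 1) (n + 1), ((j : ℚ) - i) = ((n - i).factorial : ℚ) := by
    rw [prod_Ico_eq_prod_range, Nat.factorial_eq_prod_range_add_one, Nat.cast_prod]
    have : n + 1 - (i + 1) = n - i := by omega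
    rw [this]
    refine prod_congr rfl fun k _ => ?_
    push_cast
    ring
  rw [h1, h2]

/-- **Lagrange division.** For a polynomial `P` of degree `≤ n` and `t ∉ {-1, …, -(n+1)}`,
`P(t)/(t+1)_{n+1} = ∑_{m ≤ n} P(-m-1) (-1)^m / (m! (n-m)!) · 1/(t+m+1)` (Lagrange interpolation
at the nodes `-1, …, -(n+1)`, first barycentric form). [folklore] -/
theorem lagrange_div (n : ℕ) (P : ℚ[X]) (hP : P.degree < ((n + 1 : ℕ) : WithBot ℕ)) (t : ℚ)
    (ht : ∀ m, m ≤ n → t + m + 1 ≠ 0) :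
    P.eval t / poch (t + 1) (n + 1) =
      ∑ m ∈ range (n + 1),
        P.eval (-(m : ℚ) - 1) * ((-1) ^ m / ((m.factorial : ℚ) * (n - m).factorial)) /
          (t + m + 1) := by
  classical
  set v : ℕ → ℚ := fun m => -(m : ℚ) - 1 with hv
  have hvs : Set.InjOn v (range (n + 1)) := by
    intro a _ b _ h
    simp only [hv] at h
    exact_mod_cast (by linarith : (a : ℚ) = b)
  have hcard : P.degree < #(range (n + 1)) := by rwa [card_range]
  have hx : ∀ i ∈ range (n + 1), t ≠ v i := by
    intro i hi h
    apply ht i (Nat.lt_succ_iff.1 (mem_range.1 hi))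
    rw [h, hv]
    ring
  have key := Lagrange.eval_interpolate_not_at_node (fun i => P.eval (v i)) hx
  rw [← Lagrange.eq_interpolate hvs hcard] at key
  have hnodal : eval t (Lagrange.nodal (range (n + 1)) v) = poch (t + 1) (n + 1) := by
    rw [Lagrange.eval_nodal, poch]
    refine prod_congr rfl fun i _ => ?_
    rw [hv]
    ring
  have hpoch : poch (t + 1) (n + 1) ≠ 0 := by
    rw [poch]
    exact prod_ne_zero_iff.2 fun m hm => by
      have := ht m (Nat.lt_succ_iff.1 (mem_range.1 hm))
      intro h
      apply this
      linarith
  rw [key, hnodal, mul_div_cancel_left₀ _ hpoch]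
  refine sum_congr rfl fun i hi => ?_
  have hi' : i ≤ n := Nat.lt_succ_iff.1 (mem_range.1 hi)
  have hw : Lagrange.nodalWeight (range (n + 1)) v i =
      (-1) ^ i / ((i.factorial : ℚ) * (n - i).factorial) := by
    rw [Lagrange.nodalWeight]
    have : ∏ j ∈ (range (n + 1)).erase i, (v i - v j)⁻¹ =
        (∏ j ∈ (range (n + 1)).erase i, ((j : ℚ) - i))⁻¹ := by
      rw [← prod_inv_distrib]
      refine prod_congr rfl fun j _ => ?_
      rw [hv]
      ring
    rw [this, prod_erase_sub n i hi']
    have hf : ((i.factorial : ℚ) * (n - i).factorial) ≠ 0 := by positivity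
    field_simp
    rw [← pow_mul, mul_comm, pow_mul]
    norm_num
  rw [hw, hv]
  have : t - (-(i : ℚ) - 1) = t + i + 1 := by ring
  rw [this]
  ring

/-! ### The three bricks -/

/-- Residues of `H(t) = n!/(t+1)_{n+1}`: `A_m = (-1)^m C(n,m)`. [cite: Rivoal2000, §2 proof of Lemme 5] -/
def resH (n m : ℕ) : ℤ := (-1) ^ m * (n.choose m : ℤ)

/-- Residues of `F_l(t) = (t-nl+1)_n/(t+1)_{n+1}`: `A_m = (-1)^{n+m} C(n,m) C(m+nl,n)`.
[cite: Rivoal2000, §2 proof of Lemme 5] -/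
def resF (n l m : ℕ) : ℤ := (-1) ^ (n + m) * (n.choose m : ℤ) * ((m + n * l).choose n : ℤ)

/-- Residues of `G_l(t) = (t+nl+2)_n/(t+1)_{n+1}`: `A_m = (-1)^m C(n,m) C(n(l+1)-m,n)`.
[cite: Rivoal2000, §2 proof of Lemme 5] -/
def resG (n l m : ℕ) : ℤ := (-1) ^ m * (n.choose m : ℤ) * ((n * (l + 1) - m).choose n : ℤ)

/-- `H(t) = n!/(t+1)_{n+1} = ∑_m (-1)^m C(n,m)/(t+m+1)`. [cite: Rivoal2000, §2 proof of Lemme 5] -/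
theorem H_eq_brickEval (n : ℕ) (t : ℚ) (ht : ∀ m, m ≤ n → t + m + 1 ≠ 0) :
    (n.factorial : ℚ) / poch (t + 1) (n + 1) = brickEval n (resH n) t := by
  have hdeg : (C (n.factorial : ℚ)).degree < ((n + 1 : ℕ) : WithBot ℕ) :=
    lt_of_le_of_lt degree_C_le (by exact_mod_cast Nat.succ_pos n)
  have h := lagrange_div n (C (n.factorial : ℚ)) hdeg t ht
  rw [eval_C] at h
  rw [h, brickEval]
  refine sum_congr rfl fun m hm => ?_
  have hm' : m ≤ n := Nat.lt_succ_iff.1 (mem_range.1 hm)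
  rw [eval_C, resH]
  push_cast
  rw [Nat.cast_choose ℚ hm']
  have hf : ((m.factorial : ℚ) * (n - m).factorial) ≠ 0 := by positivity
  field_simp

/-- The numerator polynomial `∏_{s<n} (X + β + s)`, `eval t = (t + β)_n`, degree `n`. [folklore] -/
def pochPoly (β : ℚ) (n : ℕ) : ℚ[X] := ∏ s ∈ range n, (X + C (β + s))

/-- `eval t (pochPoly β n) = (t+β)_n`. [folklore] -/
theorem eval_pochPoly (β : ℚ) (n : ℕ) (t : ℚ) : (pochPoly β n).eval t = poch (t + β) n := by
  rw [pochPoly, eval_prod, poch]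
  refine prod_congr rfl fun s _ => ?_
  rw [eval_add, eval_X, eval_C]
  ring

/-- `deg (pochPoly β n) < n + 1`. [folklore] -/
theorem degree_pochPoly_lt (β : ℚ) (n : ℕ) :
    (pochPoly β n).degree < ((n + 1 : ℕ) : WithBot ℕ) := by
  have h : (pochPoly β n).natDegree ≤ n := by
    unfold pochPoly
    refine (natDegree_prod_le _ _).trans ?_
    refine (sum_le_sum (fun (s : ℕ) _ => (natDegree_X_add_C (β + ((s : ℕ) : ℚ))).le)).trans ?_
    simp
  have h2 : (pochPoly β n).degree ≤ (n : WithBot ℕ) := degree_le_of_natDegree_le h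
  exact h2.trans_lt (WithBot.coe_lt_coe.2 (Nat.lt_succ_self n))

/-- A brick with Pochhammer numerator: `(t+β)_n/(t+1)_{n+1} = ∑_m A_m/(t+m+1)` as soon as
`A_m = (β-m-1)_n (-1)^m/(m!(n-m)!)`. [folklore] -/
theorem poch_div_eq_brickEval (n : ℕ) (β : ℚ) (A : ℕ → ℤ)
    (hA : ∀ m, m ≤ n → (A m : ℚ) =
      poch (β - m - 1) n * ((-1) ^ m / ((m.factorial : ℚ) * (n - m).factorial)))
    (t : ℚ) (ht : ∀ m, m ≤ n → t + m + 1 ≠ 0) :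
    poch (t + β) n / poch (t + 1) (n + 1) = brickEval n A t := by
  have h := lagrange_div n (pochPoly β n) (degree_pochPoly_lt β n) t ht
  rw [eval_pochPoly] at h
  rw [h, brickEval]
  refine sum_congr rfl fun m hm => ?_
  have hm' : m ≤ n := Nat.lt_succ_iff.1 (mem_range.1 hm)
  rw [eval_pochPoly, hA m hm']
  congr 2
  ring_nf

/-- `F_l(t) = (t - nl + 1)_n/(t+1)_{n+1} = ∑_m (-1)^{n+m} C(n,m) C(m+nl,n)/(t+m+1)`.
[cite: Rivoal2000, §2 proof of Lemme 5] -/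
theorem F_eq_brickEval (n l : ℕ) (t : ℚ) (ht : ∀ m, m ≤ n → t + m + 1 ≠ 0) :
    poch (t - n * l + 1) n / poch (t + 1) (n + 1) = brickEval n (resF n l) t := by
  have h := poch_div_eq_brickEval n (1 - n * l) (resF n l) (fun m hm => by
    have e : (1 - (n : ℚ) * l) - m - 1 = -((m + n * l : ℕ) : ℚ) := by push_cast; ring
    rw [e, poch_neg_natCast, resF]
    have hf : ((m.factorial : ℚ) * (n - m).factorial) ≠ 0 := by positivity
    push_cast
    rw [Nat.cast_choose ℚ hm]
    field_simp
    ring) t ht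
  rw [← h]
  congr 2
  ring

/-- `G_l(t) = (t + nl + 2)_n/(t+1)_{n+1} = ∑_m (-1)^m C(n,m) C(n(l+1)-m,n)/(t+m+1)` (`1 ≤ l`).
[cite: Rivoal2000, §2 proof of Lemme 5] -/
theorem G_eq_brickEval (n l : ℕ) (hl : 1 ≤ l) (t : ℚ) (ht : ∀ m, m ≤ n → t + m + 1 ≠ 0) :
    poch (t + n * l + 2) n / poch (t + 1) (n + 1) = brickEval n (resG n l) t := by
  have h := poch_div_eq_brickEval n (n * l + 2) (resG n l) (fun m hm => by
    have hmn : m ≤ n * l := hm.trans (Nat.le_mul_of_pos_right n hl)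
    have e : ((n : ℚ) * l + 2) - m - 1 = ((n * l - m : ℕ) : ℚ) + 1 := by
      rw [Nat.cast_sub hmn]
      push_cast
      ring
    rw [e, poch_natCast_succ, resG]
    have hf : ((m.factorial : ℚ) * (n - m).factorial) ≠ 0 := by positivity
    have e2 : n * l - m + n = n * (l + 1) - m := by
      have := Nat.le_mul_of_pos_right n hl
      rw [Nat.mul_succ]
      omega
    rw [e2]
    push_cast
    rw [Nat.cast_choose ℚ hm]
    field_simp) t ht
  rw [← h]
  congr 2
  ring

/-! ### Bounds for the residues -/

/-- `∑_m |A^H_m| = 2^n`. [folklore] -/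
theorem sum_abs_resH (n : ℕ) : ∑ m ∈ range (n + 1), |(resH n m : ℚ)| = 2 ^ n := by
  have h : ∀ m ∈ range (n + 1), |(resH n m : ℚ)| = (n.choose m : ℚ) := by
    intro m _
    rw [resH]
    push_cast
    rw [abs_mul, abs_pow, abs_neg, abs_one, one_pow, one_mul, Nat.abs_cast]
  rw [sum_congr rfl h, ← Nat.cast_sum, Nat.sum_range_choose]
  push_cast
  ring

/-- `∑_m |A^{F_l}_m| ≤ 2^n C(n(l+1), n)`. [folklore] -/
theorem sum_abs_resF_le (n l : ℕ) :
    ∑ m ∈ range (n + 1), |(resF n l m : ℚ)| ≤ 2 ^ n * ((n * (l + 1)).choose n : ℚ) := by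
  have h : ∀ m ∈ range (n + 1), |(resF n l m : ℚ)| ≤ (n.choose m : ℚ) * ((n * (l + 1)).choose n : ℚ) := by
    intro m hm
    have hm' : m ≤ n := Nat.lt_succ_iff.1 (mem_range.1 hm)
    rw [resF]
    push_cast
    rw [abs_mul, abs_mul, abs_pow, abs_neg, abs_one, one_pow, one_mul, Nat.abs_cast,
      Nat.abs_cast]
    gcongr
    · show m + n * l ≤ n * l + n
      omega
  refine (sum_le_sum h).trans ?_
  rw [← sum_mul, ← Nat.cast_sum, Nat.sum_range_choose]
  push_cast
  exact le_refl _

/-- `∑_m |A^{G_l}_m| ≤ 2^n C(n(l+1), n)`. [folklore] -/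
theorem sum_abs_resG_le (n l : ℕ) :
    ∑ m ∈ range (n + 1), |(resG n l m : ℚ)| ≤ 2 ^ n * ((n * (l + 1)).choose n : ℚ) := by
  have h : ∀ m ∈ range (n + 1), |(resG n l m : ℚ)| ≤ (n.choose m : ℚ) * ((n * (l + 1)).choose n : ℚ) := by
    intro m _
    rw [resG]
    push_cast
    rw [abs_mul, abs_mul, abs_pow, abs_neg, abs_one, one_pow, one_mul, Nat.abs_cast,
      Nat.abs_cast]
    gcongr
    · exact Nat.sub_le _ _
  refine (sum_le_sum h).trans ?_
  rw [← sum_mul, ← Nat.cast_sum, Nat.sum_range_choose]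
  push_cast
  exact le_refl _

/-! ### Rivoal's rational function `R_n` and its brick decomposition -/

/-- Rivoal's rational function
`R_n(t) = n!^{a-2r} (t-rn+1)_{rn} (t+n+2)_{rn} / (t+1)_{n+1}^a` ([Rivoal2000, §1], the general
term of the series `S_n(z) = ∑_{k ≥ 0} R_n(k) z^{-k}`), as a function `ℚ → ℚ`.
[cite: Rivoal2000, §1 (definition of S_n and R_n)] -/
def R (a r n : ℕ) (t : ℚ) : ℚ :=
  (n.factorial : ℚ) ^ (a - 2 * r) * poch (t - r * n + 1) (r * n) * poch (t + n + 2) (r * n) /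
    poch (t + 1) (n + 1) ^ a

/-- The `a` bricks of `R_n`: `F_1, …, F_r, G_1, …, G_r` and `a - 2r` copies of `H`, by their
residues. [cite: Rivoal2000, §2 proof of Lemme 5] -/
def bricks (r n s : ℕ) : ℕ → ℤ :=
  if s < r then resF n (s + 1) else if s < 2 * r then resG n (s - r + 1) else resH n

/-- **`R_n` is the product of its bricks**: for `2r ≤ a` and `t ∉ {-1, …, -(n+1)}`,
`R_n(t) = ∏_{s<a} B_s(t)` with `B_s = ∑_m (bricks r n s)_m/(t+m+1)`.
[cite: Rivoal2000, §2 proof of Lemme 5] -/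
theorem R_eq_prod_brickEval (a r n : ℕ) (har : 2 * r ≤ a) (t : ℚ)
    (ht : ∀ m, m ≤ n → t + m + 1 ≠ 0) :
    R a r n t = ∏ s ∈ range a, brickEval n (bricks r n s) t := by
  have hpoch : poch (t + 1) (n + 1) ≠ 0 := by
    rw [poch]
    exact prod_ne_zero_iff.2 fun m hm => by
      have := ht m (Nat.lt_succ_iff.1 (mem_range.1 hm))
      intro h
      apply this
      linarith
  -- split the product of bricks into the three blocks
  have ha : a = r + (r + (a - 2 * r)) := by omega
  have hprod : ∏ s ∈ range a, brickEval n (bricks r n s) t =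
      (∏ L ∈ range r, brickEval n (resF n (L + 1)) t) *
        ((∏ L ∈ range r, brickEval n (resG n (L + 1)) t) *
          ∏ _s ∈ range (a - 2 * r), brickEval n (resH n) t) := by
    rw [ha, prod_range_add, prod_range_add]
    have e3 : r + (r + (a - 2 * r)) - 2 * r = a - 2 * r := by omega
    congr 1
    · exact prod_congr rfl fun s hs => by rw [bricks, if_pos (mem_range.1 hs)]
    · congr 1
      · refine prod_congr rfl fun s hs => ?_
        have hs' := mem_range.1 hs
        rw [bricks, if_neg (by omega), if_pos (by omega)]
        congr 2
        omega
      · rw [e3]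
        refine prod_congr rfl fun s _ => ?_
        rw [bricks, if_neg (by omega), if_neg (by omega)]
  rw [hprod]
  -- the three blocks as Pochhammer quotients
  have hDr : poch (t + 1) (n + 1) ^ r = ∏ _L ∈ range r, poch (t + 1) (n + 1) := by
    rw [prod_const, card_range]
  have hF : ∏ L ∈ range r, brickEval n (resF n (L + 1)) t =
      poch (t - r * n + 1) (r * n) / poch (t + 1) (n + 1) ^ r := by
    rw [eq_div_iff (pow_ne_zero _ hpoch), poch_mul, hDr, ← prod_mul_distrib]
    conv_rhs => rw [← prod_range_reflect]
    refine prod_congr rfl fun L hL => ?_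
    have hL' : L < r := mem_range.1 hL
    rw [← F_eq_brickEval n (L + 1) t ht, div_mul_cancel₀ _ hpoch]
    congr 1
    rw [Nat.cast_sub (by omega : L ≤ r - 1), Nat.cast_sub (by omega : 1 ≤ r)]
    push_cast
    ring
  have hG : ∏ L ∈ range r, brickEval n (resG n (L + 1)) t =
      poch (t + n + 2) (r * n) / poch (t + 1) (n + 1) ^ r := by
    rw [eq_div_iff (pow_ne_zero _ hpoch), poch_mul, hDr, ← prod_mul_distrib]
    refine prod_congr rfl fun L _ => ?_
    rw [← G_eq_brickEval n (L + 1) (Nat.succ_pos L) t ht, div_mul_cancel₀ _ hpoch]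
    congr 1
    push_cast
    ring
  have hH : ∏ _s ∈ range (a - 2 * r), brickEval n (resH n) t =
      (n.factorial : ℚ) ^ (a - 2 * r) / poch (t + 1) (n + 1) ^ (a - 2 * r) := by
    rw [prod_const, card_range, ← H_eq_brickEval n t ht, div_pow]
  rw [hF, hG, hH, R]
  have hpa : poch (t + 1) (n + 1) ^ a =
      poch (t + 1) (n + 1) ^ r * (poch (t + 1) (n + 1) ^ r * poch (t + 1) (n + 1) ^ (a - 2 * r)) := by
    rw [← pow_add, ← pow_add, ← ha]
  rw [hpa]
  field_simp

/-! ### The partial fraction expansion of `R_n` -/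

/-- The residue sums of all bricks are bounded: `∏_{s<a} ∑_m |A^{(s)}_m| ≤
2^{an} ∏_{L<r} C(n(L+2),n)^2`. [folklore] -/
theorem prod_sum_abs_bricks_le (a r n : ℕ) (har : 2 * r ≤ a) :
    ∏ s ∈ range a, ∑ m ∈ range (n + 1), |(bricks r n s m : ℚ)| ≤
      (2 : ℚ) ^ (a * n) * ∏ L ∈ range r, ((n * (L + 2)).choose n : ℚ) ^ 2 := by
  have ha : a = r + (r + (a - 2 * r)) := by omega
  have h0 : ∀ s, 0 ≤ ∑ m ∈ range (n + 1), |(bricks r n s m : ℚ)| :=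
    fun s => sum_nonneg fun _ _ => abs_nonneg _
  conv_lhs => rw [ha, prod_range_add, prod_range_add]
  have hF : ∏ s ∈ range r, ∑ m ∈ range (n + 1), |(bricks r n s m : ℚ)| ≤
      ∏ L ∈ range r, (2 : ℚ) ^ n * ((n * (L + 2)).choose n : ℚ) := by
    refine prod_le_prod (fun s _ => h0 s) fun s hs => ?_
    have : bricks r n s = resF n (s + 1) := by rw [bricks, if_pos (mem_range.1 hs)]
    rw [this]
    exact sum_abs_resF_le n (s + 1)
  have hG : ∏ s ∈ range r, ∑ m ∈ range (n + 1), |(bricks r n (r + s) m : ℚ)| ≤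
      ∏ L ∈ range r, (2 : ℚ) ^ n * ((n * (L + 2)).choose n : ℚ) := by
    refine prod_le_prod (fun s _ => h0 _) fun s hs => ?_
    have hs' := mem_range.1 hs
    have : bricks r n (r + s) = resG n (s + 1) := by
      rw [bricks, if_neg (by omega), if_pos (by omega)]
      congr 1
      omega
    rw [this]
    exact sum_abs_resG_le n (s + 1)
  have hH : ∏ s ∈ range (a - 2 * r), ∑ m ∈ range (n + 1), |(bricks r n (r + (r + s)) m : ℚ)| =
      ∏ _s ∈ range (a - 2 * r), (2 : ℚ) ^ n := by
    refine prod_congr rfl fun s _ => ?_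
    have : bricks r n (r + (r + s)) = resH n := by
      rw [bricks, if_neg (by omega), if_neg (by omega)]
    rw [this, sum_abs_resH]
  have h2 : (0 : ℚ) ≤ ∏ L ∈ range r, (2 : ℚ) ^ n * ((n * (L + 2)).choose n : ℚ) :=
    prod_nonneg fun _ _ => by positivity
  rw [hH]
  refine (mul_le_mul hF (mul_le_mul_of_nonneg_right hG (prod_nonneg fun _ _ => by positivity))
    (mul_nonneg (prod_nonneg fun s _ => h0 _) (prod_nonneg fun _ _ => by positivity)) h2).trans
    (le_of_eq ?_)
  rw [prod_mul_distrib, prod_const, card_range, prod_const, card_range, prod_pow,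
    ← pow_mul, ← pow_mul]
  have : (2 : ℚ) ^ (a * n) = 2 ^ (n * r) * 2 ^ (n * r) * 2 ^ (n * (a - 2 * r)) := by
    rw [← pow_add, ← pow_add]
    congr 1
    have h' : r + r + (a - 2 * r) = a := by omega
    calc a * n = n * (r + r + (a - 2 * r)) := by rw [h', mul_comm]
      _ = n * r + n * r + n * (a - 2 * r) := by ring
  rw [this]
  ring

/-- **Partial fractions of `R_n`** ([Rivoal2000, §2, Lemme 1 (décomposition en fractions
partielles) and Lemme 5]): for `1 ≤ a`, `2r ≤ a` and any common multiple `d` of `1, …, n` there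
are rationals `c_{o,p}` (`o < a`, `p ≤ n`; `c_{o,p}` is Rivoal's `c_{o+1,p,n}`) with
`R_n(t) = ∑_{p ≤ n} ∑_{o<a} c_{o,p}/(t+p+1)^{o+1}` for `t ∉ {-1,…,-(n+1)}`,
`d^{a-1-o} c_{o,p} ∈ ℤ`, and `∑ |c_{o,p}| ≤ a! 2^{an} ∏_{L<r} C(n(L+2),n)^2`.
[cite: Rivoal2000, §2 Lemme 5] -/
theorem exists_pf_R (a r n d : ℕ) (ha : 1 ≤ a) (har : 2 * r ≤ a)
    (hdiv : ∀ k : ℕ, 1 ≤ k → k ≤ n → (k : ℤ) ∣ d) :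
    ∃ c : ℕ → ℕ → ℚ,
      (∀ t : ℚ, (∀ m, m ≤ n → t + m + 1 ≠ 0) → pfEval n a c t = R a r n t) ∧
      IsInt a d c ∧
      l1 n a c ≤ (a.factorial : ℚ) * ((2 : ℚ) ^ (a * n) *
        ∏ L ∈ range r, ((n * (L + 2)).choose n : ℚ) ^ 2) := by
  obtain ⟨c, hc, hint, hl1⟩ := exists_pf_prod n d hdiv (bricks r n) a ha
  refine ⟨c, fun t ht => ?_, hint, hl1.trans ?_⟩
  · rw [hc t ht, R_eq_prod_brickEval a r n har t ht]
  · exact mul_le_mul_of_nonneg_left (prod_sum_abs_bricks_le a r n har) (by positivity)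

end BallRivoal

end Literature.NumberTheory.Transcendental
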